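import Summits.Ventures.PercRepro.S1SpreadSeriesBase

/-!
# PercRepro — SERIES CLASSES IN THE SPREAD CHAIN, PART B: THE SERIES-AWARE `s₄` CHAIN `gSpread` (p1, gen 35)

`proofs/P1-S2-CORANK6.md` §4q. THE STEP (`ncard_fourCircuits_le_max_of_series`): on a coloop-free spread e-free core `M` of nullity
`d + 1` on `m > 4` points, take a point `x` of degree `≤ 4·s₄/m` and let `K` be the coloops of `M ＼ {x}` (the series partners of `x`,
`k = |K|`); `M' := (M ＼ {x}) ＼ K` is a coloop-free spread e-free core of nullity `d` on `m − 1 − k` points with the same four-circuits as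
`M ＼ {x}`. If `k ≥ 4` then `x` lies on no four-circuit and `s₄ ≤ s₄(M')`; if `k ∈ {2, 3}` then `x` lies on `≤ 1` and `s₄ ≤ 1 + s₄(M')`;
if `k ≤ 1` then `s₄ ≤ 4·s₄/m + s₄(M')`, i.e. `s₄ ≤ ⌊m·s₄(M')/(m − 4)⌋`. With the bounds `Call` / `C₄` / `C₂` on coloop-free nullity-`d`
cores on `≤ m − 5` / `m − 4 … m − 3` / `m − 2 … m − 1` points: `s₄ ≤ max Call (max (1 + C₄) ⌊m·C₂/(m − 4)⌋)`.
THE CHAIN: `gSpread j m` (the no-point-count cap `bSpread j = capSum qSpreadSeven j` at `j ≤ 3`, the landed averaging at `j = 4, 5`, the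
step above from `j = 6`, every lower level read off the recursion on the admissible point counts `≥ j + 6`), and
**`ncard_fourCircuits_le_gSpread`**: `s₄ ≤ gSpread j m` on every coloop-free spread e-free core of nullity `j` on `m` points. VALUES
(`decide`): `gSpread 6 19 = 25` (landed `30`), `gSpread 7 20 = 33` (`41`), `gSpread 8 21 = 47` (`64`), `gSpread 7 19 = 34`,
`gSpread 8 20 = 47`, `gSpread 6 18 = 27` — the cells `(13, 6)`, `(13, 7)`, `(13, 8)`, `(12, 7)`, `(12, 8)`, `(12, 6)` of the row `p = 13`
and its coloop sub-cells. Nothing about any cell is claimed. Axioms: standard.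
-/

open scoped Matroid

namespace PercRepro

namespace S1

open Set

open FourCap

variable {α : Type}

/-- **Spread survives the deletion of any set** (the rank of a subset of the smaller ground set is unchanged). -/
theorem spread_delete_set (M : Matroid α) (hns : ¬ ∃ W ⊆ M.E, W.ncard ≤ 9 ∧ W.encard = M.eRk W + 4) (D : Set α) :
    ¬ ∃ W ⊆ (M ＼ D).E, W.ncard ≤ 9 ∧ W.encard = (M ＼ D).eRk W + 4 := by
  rintro ⟨W, hW, h9, hW4⟩
  rw [Matroid.delete_ground] at hW
  refine hns ⟨W, hW.trans Set.sdiff_subset, h9, ?_⟩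
  rw [Matroid.delete_eq_restrict, Matroid.restrict_eRk_eq M hW] at hW4
  exact hW4

/-- **THE SERIES-AWARE STEP** of the spread `s₄` chain (see the module docstring). -/
theorem ncard_fourCircuits_le_max_of_series (M : Matroid α) [M.Finite]
    (hfree : ∀ e ∈ M.E, ∃ A ⊆ M.E \ {e}, e ∉ M.closure A ∧ e ∉ M.closure ((M.E \ {e}) \ A))
    (hns : ¬ ∃ W ⊆ M.E, W.ncard ≤ 9 ∧ W.encard = M.eRk W + 4)
    {d : ℕ} (hd : M.E.encard = M.eRank + (d + 1)) {m : ℕ} (hm : M.E.ncard = m) (hm4 : 4 < m)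
    (hK : ∀ e, ¬ M.IsColoop e) {Call C₄ C₂ : ℕ}
    (hall : ∀ (M' : Matroid α) [M'.Finite],
      (∀ e ∈ M'.E, ∃ A ⊆ M'.E \ {e}, e ∉ M'.closure A ∧ e ∉ M'.closure ((M'.E \ {e}) \ A)) →
      (¬ ∃ W ⊆ M'.E, W.ncard ≤ 9 ∧ W.encard = M'.eRk W + 4) → M'.E.encard = M'.eRank + d →
      M'.E.ncard ≤ m - 5 → (∀ e, ¬ M'.IsColoop e) → {C : Set α | M'.IsCircuit C ∧ C.ncard = 4}.ncard ≤ Call)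
    (h4 : ∀ (M' : Matroid α) [M'.Finite],
      (∀ e ∈ M'.E, ∃ A ⊆ M'.E \ {e}, e ∉ M'.closure A ∧ e ∉ M'.closure ((M'.E \ {e}) \ A)) →
      (¬ ∃ W ⊆ M'.E, W.ncard ≤ 9 ∧ W.encard = M'.eRk W + 4) → M'.E.encard = M'.eRank + d →
      m - 4 ≤ M'.E.ncard → M'.E.ncard ≤ m - 3 → (∀ e, ¬ M'.IsColoop e) →
      {C : Set α | M'.IsCircuit C ∧ C.ncard = 4}.ncard ≤ C₄)
    (h2 : ∀ (M' : Matroid α) [M'.Finite],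
      (∀ e ∈ M'.E, ∃ A ⊆ M'.E \ {e}, e ∉ M'.closure A ∧ e ∉ M'.closure ((M'.E \ {e}) \ A)) →
      (¬ ∃ W ⊆ M'.E, W.ncard ≤ 9 ∧ W.encard = M'.eRk W + 4) → M'.E.encard = M'.eRank + d →
      m - 2 ≤ M'.E.ncard → M'.E.ncard ≤ m - 1 → (∀ e, ¬ M'.IsColoop e) →
      {C : Set α | M'.IsCircuit C ∧ C.ncard = 4}.ncard ≤ C₂) :
    {C : Set α | M.IsCircuit C ∧ C.ncard = 4}.ncard ≤ max Call (max (1 + C₄) (m * C₂ / (m - 4))) := by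
  classical
  set s := {C : Set α | M.IsCircuit C ∧ C.ncard = 4}.ncard with hs
  rcases Nat.eq_zero_or_pos s with h0 | hpos
  · rw [h0]; exact Nat.zero_le _
  -- the point of small degree
  obtain ⟨x, hxE, hxc, hx⟩ := exists_nonColoop_ncard_fourCircuitsThrough_le M hpos
  rw [← hs] at hx
  have hfilt : (M.ground_finite.toFinset.filter (fun x => ¬ M.IsColoop x)).card = m := by
    rw [Finset.filter_true_of_mem (fun x _ => hK x), ← ncard_eq_toFinset_card _ M.ground_finite, hm]
  rw [hfilt] at hx
  -- the deletion and its coloops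
  set N := M ＼ {x} with hN
  set K := N.coloops with hKdef
  set M' := N ＼ K with hM'
  have hKsub : K ⊆ M.E \ {x} := coloops_delete_subset M x
  have hKfin : K.Finite := M.ground_finite.subset (hKsub.trans sdiff_subset)
  have hdN : N.E.encard = N.eRank + d := nullity_delete_singleton_of_not_isColoop M hxE hxc hd
  have hdM' : M'.E.encard = M'.eRank + d := nullity_delete_coloops N hdN
  have hfree' := S1.hfree_delete_set N (S1.hfree_delete M hfree x) K
  have hns' := spread_delete_set N (spread_delete M hns x) K
  have hK' : ∀ e, ¬ M'.IsColoop e := fun e => not_isColoop_delete_coloops N e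
  have hnM' : M'.E.ncard = m - 1 - K.ncard := by
    have h1 : N.E = M.E \ {x} := Matroid.delete_ground M {x}
    have h2 : M'.E = N.E \ K := Matroid.delete_ground N K
    rw [h2, Set.ncard_sdiff (by rw [h1]; exact hKsub) hKfin, h1, ncard_sdiff_singleton_of_mem hxE, hm]
  have hsplit := ncard_fourCircuits_le_through_add_delete M x
  have hsame : {C : Set α | N.IsCircuit C ∧ C.ncard = 4}.ncard = {C : Set α | M'.IsCircuit C ∧ C.ncard = 4}.ncard := by
    rw [hM', fourCircuits_delete_coloops_eq N]
  rw [← hs, hsame] at hsplit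
  -- the three cases on the number of series partners
  rcases Nat.lt_or_ge K.ncard 2 with hk1 | hk2
  · -- `k ≤ 1`: the averaging
    have hb := h2 M' hfree' hns' hdM' (by omega) (by omega) hK'
    have hsub : s - 4 * s / m ≤ C₂ := by omega
    exact (le_mul_div_of_sub_div_le hm4 hsub).trans (le_max_of_le_right (le_max_right _ _))
  rcases Nat.lt_or_ge K.ncard 4 with hk3 | hk4
  · -- `k ∈ {2, 3}`: at most one circuit through `x`
    have hdeg := ncard_fourCircuitsThrough_le_one_of_two_le_coloops_delete M hfree hK (x := x) hk2
    have hb := h4 M' hfree' hns' hdM' (by omega) (by omega) hK'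
    have : s ≤ 1 + C₄ := by omega
    exact this.trans (le_max_of_le_right (le_max_left _ _))
  · -- `k ≥ 4`: no circuit through `x`
    have hdeg := ncard_fourCircuitsThrough_eq_zero_of_four_le_coloops_delete M hK (x := x) hk4
    have hb := hall M' hfree' hns' hdM' (by omega) hK'
    have : s ≤ Call := by omega
    exact this.trans (le_max_left _ _)

/-- The no-point-count spread chain `bSpread j = Σ_{i ≤ j} qSpreadSeven i` (`0, 1, 5, 10, 16, 24, 33, 52, 104, …`). -/
def bSpread (j : ℕ) : ℕ := capSum qSpreadSeven j

/-- **THE SERIES-AWARE SPREAD `s₄` CHAIN**: `gSpread j m` bounds `s₄` on coloop-free spread e-free cores of nullity `j` on `m` points —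
the no-point-count cap at `j ≤ 3`, the landed averaging `min (bSpread j) ⌊m·bSpread (j − 1)/(m − 4)⌋` at `j = 4, 5`, and from `j = 6` the
series-aware step with the lower level read on the admissible point counts (a nullity-`j` spread core has `≥ j + 6` points). -/
def gSpread : ℕ → ℕ → ℕ
  | 0, _ => 0
  | j + 1, m =>
    if j + 1 ≤ 3 then bSpread (j + 1)
    else if j + 1 ≤ 5 then min (bSpread (j + 1)) (m * bSpread j / (m - 4))
    else min (bSpread (j + 1)) (max ((Finset.Icc (j + 6) (m - 5)).sup (gSpread j))
      (max (1 + (Finset.Icc (max (j + 6) (m - 4)) (m - 3)).sup (gSpread j))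
        (m * (Finset.Icc (max (j + 6) (m - 2)) (m - 1)).sup (gSpread j) / (m - 4))))

/-- **`s₄ ≤ gSpread j m` on every coloop-free spread e-free core of nullity `j` on `m` points.** -/
theorem ncard_fourCircuits_le_gSpread (j : ℕ) : ∀ (M : Matroid α) [M.Finite],
    (∀ e ∈ M.E, ∃ A ⊆ M.E \ {e}, e ∉ M.closure A ∧ e ∉ M.closure ((M.E \ {e}) \ A)) →
    (¬ ∃ W ⊆ M.E, W.ncard ≤ 9 ∧ W.encard = M.eRk W + 4) → M.E.encard = M.eRank + j → ∀ m : ℕ, M.E.ncard = m →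
    (∀ e, ¬ M.IsColoop e) → {C : Set α | M.IsCircuit C ∧ C.ncard = 4}.ncard ≤ gSpread j m := by
  induction j with
  | zero =>
    intro M _ hfree hns hd m hm hK
    have h := ncard_fourCircuits_le_capSum_qSpreadSeven M hfree hns hd
    have h0 : capSum qSpreadSeven 0 = 0 := by decide
    rw [h0] at h
    simpa [gSpread] using h
  | succ j ih =>
    intro M _ hfree hns hd m hm hK
    have hnon : {C : Set α | M.IsCircuit C ∧ C.ncard = 4}.ncard ≤ bSpread (j + 1) :=
      ncard_fourCircuits_le_capSum_qSpreadSeven M hfree hns hd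
    simp only [gSpread]
    split_ifs with h3 h5
    · exact hnon
    · -- `j + 1 ∈ {4, 5}`: the landed averaging with the no-point-count cap one level down
      refine le_min hnon ?_
      have hfloor := nullity_add_six_le_ncard_of_spread M hns hd (by omega)
      rw [hm] at hfloor
      have hcol : M.coloops = ∅ := S2.coloops_eq_empty_of_forall_not M hK
      have hm' : m ≤ (M.E \ M.coloops).ncard := by rw [hcol, Set.sdiff_empty, hm]
      have h := ncard_fourCircuits_sub_div_le_of_nonColoops_spread M hfree hns (d := j) hd (by omega) hm'
        (B := bSpread j) (fun M' _ hfree' hns' hd' => ncard_fourCircuits_le_capSum_qSpreadSeven M' hfree' hns' hd')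
      exact le_mul_div_of_sub_div_le (by omega) h
    · -- `j + 1 ≥ 6`: the series-aware step, the lower level by the induction hypothesis on the admissible point counts
      refine le_min hnon ?_
      have hfloor := nullity_add_six_le_ncard_of_spread M hns hd (by omega)
      rw [hm] at hfloor
      refine ncard_fourCircuits_le_max_of_series M hfree hns hd hm (by omega) hK ?_ ?_ ?_
      · intro M' _ hfree' hns' hd' hle hK'
        have hfl := nullity_add_six_le_ncard_of_spread M' hns' hd' (by omega)
        exact (ih M' hfree' hns' hd' _ rfl hK').trans (Finset.le_sup (f := gSpread j) (Finset.mem_Icc.2 ⟨hfl, hle⟩))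
      · intro M' _ hfree' hns' hd' hge hle hK'
        have hfl := nullity_add_six_le_ncard_of_spread M' hns' hd' (by omega)
        exact (ih M' hfree' hns' hd' _ rfl hK').trans
          (Finset.le_sup (f := gSpread j) (Finset.mem_Icc.2 ⟨max_le hfl hge, hle⟩))
      · intro M' _ hfree' hns' hd' hge hle hK'
        have hfl := nullity_add_six_le_ncard_of_spread M' hns' hd' (by omega)
        exact (ih M' hfree' hns' hd' _ rfl hK').trans
          (Finset.le_sup (f := gSpread j) (Finset.mem_Icc.2 ⟨max_le hfl hge, hle⟩))

/-- The values of the chain on the cells of the row `p = 13` and its coloop sub-cells. -/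
theorem gSpread_values :
    gSpread 6 18 = 27 ∧ gSpread 6 19 = 25 ∧ gSpread 7 19 = 34 ∧ gSpread 7 20 = 33 ∧ gSpread 8 20 = 47 ∧ gSpread 8 21 = 47 := by
  decide

/-- **THE `(13, 7)` SPREAD `s₄` CAP, SERIES-AWARE: `s₄ ≤ 33`** on the coloop-free spread e-free core of nullity `7` on `20` points
(the landed averaging gave `41`). -/
theorem ncard_fourCircuits_le_thirty_three_spread_twenty (M : Matroid α) [M.Finite]
    (hfree : ∀ e ∈ M.E, ∃ A ⊆ M.E \ {e}, e ∉ M.closure A ∧ e ∉ M.closure ((M.E \ {e}) \ A))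
    (hns : ¬ ∃ W ⊆ M.E, W.ncard ≤ 9 ∧ W.encard = M.eRk W + 4) (hd : M.E.encard = M.eRank + 7)
    (hn : M.E.ncard = 20) (hK : ∀ e, ¬ M.IsColoop e) :
    {C : Set α | M.IsCircuit C ∧ C.ncard = 4}.ncard ≤ 33 := by
  have h := ncard_fourCircuits_le_gSpread 7 M hfree hns hd 20 hn hK
  rw [gSpread_values.2.2.2.1] at h
  exact h

/-- **THE `(13, 8)` SPREAD `s₄` CAP, SERIES-AWARE: `s₄ ≤ 47`** on `21` points at nullity `8` (the landed averaging gave `64`). -/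
theorem ncard_fourCircuits_le_forty_seven_spread_twenty_one (M : Matroid α) [M.Finite]
    (hfree : ∀ e ∈ M.E, ∃ A ⊆ M.E \ {e}, e ∉ M.closure A ∧ e ∉ M.closure ((M.E \ {e}) \ A))
    (hns : ¬ ∃ W ⊆ M.E, W.ncard ≤ 9 ∧ W.encard = M.eRk W + 4) (hd : M.E.encard = M.eRank + 8)
    (hn : M.E.ncard = 21) (hK : ∀ e, ¬ M.IsColoop e) :
    {C : Set α | M.IsCircuit C ∧ C.ncard = 4}.ncard ≤ 47 := by
  have h := ncard_fourCircuits_le_gSpread 8 M hfree hns hd 21 hn hK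
  rw [gSpread_values.2.2.2.2.2] at h
  exact h

/-- **THE `(13, 6)` SPREAD `s₄` CAP, SERIES-AWARE: `s₄ ≤ 25`** on `19` points at nullity `6` (the landed averaging gave `30`). -/
theorem ncard_fourCircuits_le_twenty_five_spread_nineteen (M : Matroid α) [M.Finite]
    (hfree : ∀ e ∈ M.E, ∃ A ⊆ M.E \ {e}, e ∉ M.closure A ∧ e ∉ M.closure ((M.E \ {e}) \ A))
    (hns : ¬ ∃ W ⊆ M.E, W.ncard ≤ 9 ∧ W.encard = M.eRk W + 4) (hd : M.E.encard = M.eRank + 6)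
    (hn : M.E.ncard = 19) (hK : ∀ e, ¬ M.IsColoop e) :
    {C : Set α | M.IsCircuit C ∧ C.ncard = 4}.ncard ≤ 25 := by
  have h := ncard_fourCircuits_le_gSpread 6 M hfree hns hd 19 hn hK
  rw [gSpread_values.2.1] at h
  exact h

/-- **THE `(12, 7)` SPREAD `s₄` CAP, SERIES-AWARE: `s₄ ≤ 34`** on `19` points at nullity `7` (`41` before). -/
theorem ncard_fourCircuits_le_thirty_four_spread_nineteen (M : Matroid α) [M.Finite]
    (hfree : ∀ e ∈ M.E, ∃ A ⊆ M.E \ {e}, e ∉ M.closure A ∧ e ∉ M.closure ((M.E \ {e}) \ A))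
    (hns : ¬ ∃ W ⊆ M.E, W.ncard ≤ 9 ∧ W.encard = M.eRk W + 4) (hd : M.E.encard = M.eRank + 7)
    (hn : M.E.ncard = 19) (hK : ∀ e, ¬ M.IsColoop e) :
    {C : Set α | M.IsCircuit C ∧ C.ncard = 4}.ncard ≤ 34 := by
  have h := ncard_fourCircuits_le_gSpread 7 M hfree hns hd 19 hn hK
  rw [gSpread_values.2.2.1] at h
  exact h

/-- **THE `(12, 8)` SPREAD `s₄` CAP, SERIES-AWARE: `s₄ ≤ 47`** on `20` points at nullity `8` (`65` before). -/
theorem ncard_fourCircuits_le_forty_seven_spread_twenty (M : Matroid α) [M.Finite]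
    (hfree : ∀ e ∈ M.E, ∃ A ⊆ M.E \ {e}, e ∉ M.closure A ∧ e ∉ M.closure ((M.E \ {e}) \ A))
    (hns : ¬ ∃ W ⊆ M.E, W.ncard ≤ 9 ∧ W.encard = M.eRk W + 4) (hd : M.E.encard = M.eRank + 8)
    (hn : M.E.ncard = 20) (hK : ∀ e, ¬ M.IsColoop e) :
    {C : Set α | M.IsCircuit C ∧ C.ncard = 4}.ncard ≤ 47 := by
  have h := ncard_fourCircuits_le_gSpread 8 M hfree hns hd 20 hn hK
  rw [gSpread_values.2.2.2.2.1] at h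
  exact h

/-- **THE `(12, 6)` SPREAD `s₄` CAP, SERIES-AWARE: `s₄ ≤ 27`** on `18` points at nullity `6` (`30` before). -/
theorem ncard_fourCircuits_le_twenty_seven_spread_eighteen (M : Matroid α) [M.Finite]
    (hfree : ∀ e ∈ M.E, ∃ A ⊆ M.E \ {e}, e ∉ M.closure A ∧ e ∉ M.closure ((M.E \ {e}) \ A))
    (hns : ¬ ∃ W ⊆ M.E, W.ncard ≤ 9 ∧ W.encard = M.eRk W + 4) (hd : M.E.encard = M.eRank + 6)
    (hn : M.E.ncard = 18) (hK : ∀ e, ¬ M.IsColoop e) :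
    {C : Set α | M.IsCircuit C ∧ C.ncard = 4}.ncard ≤ 27 := by
  have h := ncard_fourCircuits_le_gSpread 6 M hfree hns hd 18 hn hK
  rw [gSpread_values.1] at h
  exact h

end S1

end PercRepro
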